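import Summits.ValiantsHypothesis.ValiantsHypothesis.Theorems.EquivariantDialInduction
import Summits.ValiantsHypothesis.ValiantsHypothesis.Theorems.EquivariantDialDiagonalNotQP
import Summits.ValiantsHypothesis.ValiantsHypothesis.Theorems.SymPencilSymmetrizePermPairsInducedBlockPencil
import Literature.Computability.AlgebraicComplexity.StandardFamiliesProofs
import HarnessLib

/-!
# Equivariant dial — the INDEX LEMMA, consequences: poly-index descent, poly-order costume, instances

Support file for cell A (`EqHardBiPerm`, item `stmt-ValiantsHypothesis-23702` of the route
`DefinabilityGap/SymmetryDial`); O-L1-25 (lens-1 g33), file 2 of 2 (`ℂ`, `per_m`).  File 1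
(`EquivariantDialInduction`) is the ENGINE: Frobenius induction of exactly equivariant layered programs —
the induced program `(1/r) · ⊕ᵢ P(aᵢ · x)` over a transversal (`HasLayeredWidthLE.of_relIndex`), width
cost = the relative index.  This file draws the consequences on the dial `H ↦ EqHard H`:

* DIAL LAW (descent): `polyLayered_of_relIndex`, `eqHardLayered_of_relIndex`, ★ `eqHard_iff_of_relIndex` —
  for `H' m ≤ H m ≤ biPermSubst m` with `[H m : H' m]` polynomially bounded, `EqHard H ↔ EqHard H'`:
  cell A is invariant along poly-index chains below the window (induction up at width cost = index,
  restriction down by `EqHard.mono`).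
* POLY-ORDER ⇒ COSTUME: `symCheap_of_card`, ★ `eqHard_iff_W_of_card` — a notch of polynomially bounded
  ORDER inside `Stab(per_m)` symmetrises for free (induce from `⊥`), so its `EqHard` is EQUIVALENT to
  `W = DcPerSuperpolynomial ℂ`.
* Instances, all images of subgroups of `𝔖_m × 𝔖_m` under the substitution hom `biPermHom`:
  (1) the cyclic row notch `C_m × 1` (`rowCycleSubst`) is a COSTUME of `W` (★ `symCheap_rowCycle`,
  ★ `eqHard_rowCycle_iff`); (2) P-ROW ⟺ P-ALT-ROW (★ `eqHard_row_iff_rowAlt`: `EqHard rowSubst ↔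
  EqHard rowAltSubst`, index `≤ 2`) — both sides UNDECIDED; (3) the alternating diagonal `Δ𝔄_m`
  (`diagAltSubst`) is HARD (★ `eqHard_diagAlt`), by DESCENT at index `≤ 2` from the tree's `eqHard_diag`
  — a WEAKER, `S`-implied cell, not reachable from `Δ𝔖_m` by monotonicity.

DELTA (vs `SymPencilEquivariantSdcNotQP.stub_induce`): that stub symmetrises PENCILS to the FULL window
at quasi-polynomial cost via `permify`; here the objects are LAYERED PROGRAMS, the symmetrisation is
RELATIVE to a pair `H' ≤ H` (any sub-window notch, not only the window), the cost is the INDEX (polynomial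
when the index is), and the engine (file 1) works over any field in which the index is invertible.
Reused BY NAME (no re-proofs, no edits of tree files): `eqHard_diag`, `eqHard_iff_layered_of_le`,
`dcPerSuperpolynomial_iff_eqHardLayered_bot`, `polyEquivariant_of_polyLayered`, `perPoly_linSubst_permPair`,
`finite_of_le_biPermSubst`, `diagPermSubst_le_biPermSubst`, `EqHard.mono`, `eqHard_iff_W_of_symCheap`.

HONEST BOUNDARY: 0 S-currency; closes NO item; the index lemma moves cell A only along chains of polynomially bounded index — P-ROW (𝔖_m × 1) stays OPEN · IDEA-NEEDED, and its hardness, if any, is invisible to poly-index / poly-order arguments ([𝔖_m × 1 : C_m × 1] = (m−1)!); every notch of polynomially bounded order inside Stab(per_m) is a COSTUME of W = DcPerSuperpolynomial ℂ; VP ≠ VNP is untouched.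

NOT claimed: anything about P-ROW itself (`EqHard rowSubst` is UNDECIDED — only its equivalence with the
alternating rows is proved), any symmetrisation across a super-polynomial index, any lower bound for
`per_m`, any statement on `W` beyond the costume equivalences.  AUX (group-theory glue, [folklore]):
`relIndex_ne_zero_of_finite`, `prod_bot_eq_map_inl`, `monoidHom_inl_injective`, `diagHom_injective`,
`index_alternatingGroup_le_two`.  Sources: equivariant determinantal representations
[LandsbergRessayre2017, §1–§2]; Frobenius induction [folklore].
-/

set_option linter.dupNamespace false

noncomputable section

namespace Summit.ValiantsHypothesis.ValiantsHypothesis.Theorems.EquivariantDialPolyIndex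

open MvPolynomial Matrix Literature.Computability.AlgebraicComplexity
open Summit.ValiantsHypothesis.ValiantsHypothesis.Theorems.EquivariantDialNode
open Summit.ValiantsHypothesis.ValiantsHypothesis.Theorems.EquivariantDialLayers
open Summit.ValiantsHypothesis.ValiantsHypothesis.Theorems.EquivariantDialNotchTransfer
open Summit.ValiantsHypothesis.ValiantsHypothesis.Theorems.EquivariantDialDiagonalPermify
  (diagPermSubst diagPermSubst_le_biPermSubst)
open Summit.ValiantsHypothesis.ValiantsHypothesis.Theorems.EquivariantDialDiagonalNotQP (eqHard_diag)
open Summit.ValiantsHypothesis.ValiantsHypothesis.Theorems.SymPencilSymmetrizePermPairs.InducedBlock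
  (perPoly_linSubst_permPair)

variable {H H' : ∀ m : ℕ, Subgroup (GL (Fin m × Fin m) ℂ)}

/-- AUX: a subgroup has non-zero (i.e. finite) relative index in every finite subgroup. [folklore] -/
theorem relIndex_ne_zero_of_finite {G : Type*} [Group G] (K K' : Subgroup G) (hK' : Finite K') :
    K.relIndex K' ≠ 0 := by
  haveI := hK'
  exact Subgroup.index_ne_zero_of_finite (H := K.subgroupOf K')

/-- The window stabilises the permanent. -/
theorem biPermSubst_le_linStabilizer (m : ℕ) : biPermSubst m ≤ linStabilizer (perPoly (Fin m) ℂ) := by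
  intro γ hγ
  rw [mem_linStabilizer, linSubstRep_apply]
  exact perPoly_linSubst_permPair m γ hγ

/-- ★ **POLY-INDEX INDUCTION on the dial.**  Polynomial layered width is inherited UPWARD along inclusions
`H' m ≤ H m ≤ Stab(per_m)` of polynomially bounded (finite) index. -/
theorem polyLayered_of_relIndex (h : PolyLayered H') (hle : ∀ m, H' m ≤ H m)
    (hstab : ∀ m, H m ≤ linStabilizer (perPoly (Fin m) ℂ))
    (hidx : IsPBounded fun m => (H' m).relIndex (H m)) (hfin : ∀ m, (H' m).relIndex (H m) ≠ 0) :
    PolyLayered H := by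
  obtain ⟨c, hc⟩ := h
  obtain ⟨e, he⟩ :=
    IsPBounded.mul_holds (⟨c, fun _ => le_rfl⟩ : IsPBounded fun m : ℕ => m ^ c + c) hidx
  refine ⟨e, fun m => ?_⟩
  obtain ⟨w, hw, hP⟩ := hc m
  exact ⟨w * (H' m).relIndex (H m), (Nat.mul_le_mul_right _ hw).trans (he m),
    hP.of_relIndex (perPoly_ne_zero (Fin m) ℂ) (hle m) (hstab m) (Nat.cast_ne_zero.mpr (hfin m))⟩

/-- ★ **POLY-INDEX DESCENT of layered hardness.** -/
theorem eqHardLayered_of_relIndex (h : EqHardLayered H) (hle : ∀ m, H' m ≤ H m)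
    (hstab : ∀ m, H m ≤ linStabilizer (perPoly (Fin m) ℂ))
    (hidx : IsPBounded fun m => (H' m).relIndex (H m)) (hfin : ∀ m, (H' m).relIndex (H m) ≠ 0) :
    EqHardLayered H' :=
  fun h' => h (polyLayered_of_relIndex h' hle hstab hidx hfin)

/-- ★ **POLY-INDEX DESCENT of `EqHard` below the window**: cell A is decided simultaneously at `H` and at
every `H' ≤ H` of polynomially bounded index. -/
theorem eqHard_iff_of_relIndex (hle : ∀ m, H' m ≤ H m) (hwin : ∀ m, H m ≤ biPermSubst m)
    (hidx : IsPBounded fun m => (H' m).relIndex (H m)) (hfin : ∀ m, (H' m).relIndex (H m) ≠ 0) :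
    EqHard H ↔ EqHard H' := by
  refine ⟨fun h => ?_, fun h => h.mono hle⟩
  exact (eqHard_iff_layered_of_le fun m => (hle m).trans (hwin m)).mpr
    (eqHardLayered_of_relIndex ((eqHard_iff_layered_of_le hwin).mp h) hle
      (fun m => (hwin m).trans (biPermSubst_le_linStabilizer m)) hidx hfin)

/-- ★ **POLY-ORDER ⇒ CHEAP SYMMETRISATION**: a notch of polynomially bounded order inside `Stab(per)` is
`SymCheap` unconditionally. -/
theorem symCheap_of_card (hstab : ∀ m, H m ≤ linStabilizer (perPoly (Fin m) ℂ))
    (hfin : ∀ m, Finite (H m)) (hcard : IsPBounded fun m => Nat.card (H m)) : SymCheap H := by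
  intro hdc
  have hbot : PolyLayered fun m => (⊥ : Subgroup (GL (Fin m × Fin m) ℂ)) := by
    by_contra hc
    exact absurd hdc (dcPerSuperpolynomial_iff_eqHardLayered_bot.mpr hc)
  exact polyEquivariant_of_polyLayered (polyLayered_of_relIndex hbot (fun _ => bot_le) hstab
    (by simp only [Subgroup.relIndex_bot_left]; exact hcard)
    fun m => relIndex_ne_zero_of_finite _ _ (hfin m))

/-- ★ **POLY-ORDER ⇒ COSTUME**: at such a notch cell A is EQUIVALENT to `W`. -/
theorem eqHard_iff_W_of_card (hstab : ∀ m, H m ≤ linStabilizer (perPoly (Fin m) ℂ))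
    (hfin : ∀ m, Finite (H m)) (hcard : IsPBounded fun m => Nat.card (H m)) :
    EqHard H ↔ DcPerSuperpolynomial ℂ :=
  eqHard_iff_W_of_symCheap (symCheap_of_card hstab hfin hcard)

/-! ### Notches as images of permutation-pair groups -/

/-- `(σ, τ) ↦ ((i, j) ↦ (σ i, τ j))` as a monoid hom `𝔖_m × 𝔖_m →* 𝔖_{m²}`. -/
def pairPerm (m : ℕ) : Equiv.Perm (Fin m) × Equiv.Perm (Fin m) →* Equiv.Perm (Fin m × Fin m) where
  toFun p := Equiv.prodCongr p.1 p.2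
  map_one' := Equiv.ext fun _ => rfl
  map_mul' _ _ := Equiv.ext fun _ => rfl

/-- The bi-permutation SUBSTITUTION hom `𝔖_m × 𝔖_m →* GL(m²)` (value on `(σ, τ)`: the permutation matrix of
`(σ × τ)⁻¹`). -/
def biPermHom (m : ℕ) : Equiv.Perm (Fin m) × Equiv.Perm (Fin m) →* GL (Fin m × Fin m) ℂ :=
  (MonoidHom.toHomUnits
    (Matrix.permMatrixHom : Equiv.Perm (Fin m × Fin m) →* Matrix (Fin m × Fin m) (Fin m × Fin m) ℂ)).comp
    (pairPerm m)

/-- The matrix of `biPermHom m (σ, τ)` is the permutation matrix of `σ⁻¹ × τ⁻¹` (by `rfl`). -/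
theorem coe_biPermHom (m : ℕ) (σ τ : Equiv.Perm (Fin m)) :
    ((biPermHom m (σ, τ) : GL (Fin m × Fin m) ℂ) : Matrix (Fin m × Fin m) (Fin m × Fin m) ℂ) =
      Equiv.Perm.permMatrix ℂ (Equiv.prodCongr σ⁻¹ τ⁻¹) :=
  rfl

/-- `biPermHom m` is injective: a permutation matrix determines the permutation. -/
theorem biPermHom_injective (m : ℕ) : Function.Injective (biPermHom m) := by
  rintro ⟨σ, τ⟩ ⟨σ', τ'⟩ h
  have hE : ∀ p : Fin m × Fin m, Equiv.prodCongr σ⁻¹ τ⁻¹ p = Equiv.prodCongr σ'⁻¹ τ'⁻¹ p := by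
    intro p
    have h1 := congrArg (fun γ : GL (Fin m × Fin m) ℂ =>
      (γ : Matrix (Fin m × Fin m) (Fin m × Fin m) ℂ) p (Equiv.prodCongr σ⁻¹ τ⁻¹ p)) h
    simp only [coe_biPermHom, PEquiv.toMatrix_apply, Equiv.toPEquiv_apply, Option.mem_def,
      Option.some.injEq, if_true] at h1
    by_contra hne
    simp only [Ne.symm hne, if_false] at h1
    exact one_ne_zero h1
  have hσ : σ⁻¹ = σ'⁻¹ := Equiv.ext fun i => congrArg Prod.fst (hE (i, i))
  have hτ : τ⁻¹ = τ'⁻¹ := Equiv.ext fun i => congrArg Prod.snd (hE (i, i))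
  rw [inv_injective hσ, inv_injective hτ]

/-- The window is the image of `𝔖_m × 𝔖_m`. -/
theorem biPermSubst_eq_map_top (m : ℕ) : biPermSubst m = (⊤ : Subgroup _).map (biPermHom m) := by
  refine le_antisymm ?_ ?_
  · rw [biPermSubst, Subgroup.closure_le]
    rintro γ ⟨σ, τ, hγ⟩
    exact Subgroup.mem_map.mpr
      ⟨(σ⁻¹, τ⁻¹), Subgroup.mem_top _, Units.ext (by rw [coe_biPermHom, inv_inv, inv_inv, hγ])⟩
  · rw [biPermSubst]
    rintro _ ⟨⟨σ, τ⟩, -, rfl⟩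
    exact Subgroup.subset_closure ⟨σ⁻¹, τ⁻¹, coe_biPermHom m σ τ⟩

/-- Images of subgroups of `𝔖_m × 𝔖_m` are notches below the window, … -/
theorem map_biPermHom_le (m : ℕ) (K : Subgroup (Equiv.Perm (Fin m) × Equiv.Perm (Fin m))) :
    K.map (biPermHom m) ≤ biPermSubst m := by
  rw [biPermSubst_eq_map_top]
  exact Subgroup.map_mono le_top

/-- … with the same relative indices. -/
theorem relIndex_map_biPermHom (m : ℕ) (K K' : Subgroup (Equiv.Perm (Fin m) × Equiv.Perm (Fin m))) :
    (K'.map (biPermHom m)).relIndex (K.map (biPermHom m)) = K'.relIndex K :=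
  Subgroup.relIndex_map_map_of_injective K' K (biPermHom_injective m)

/-! ### Instance 1: the cyclic row notch `C_m × 1` is COSTUME -/

/-- The cyclic ROW notch `C_m × 1`: the substitutions `x_{ij} ↦ x_{i+s, j}`. -/
def rowCycleSubst (m : ℕ) : Subgroup (GL (Fin m × Fin m) ℂ) :=
  (Subgroup.zpowers ((finRotate m, 1) : Equiv.Perm (Fin m) × Equiv.Perm (Fin m))).map (biPermHom m)

/-- The cyclic row notch lies below the window. -/
theorem rowCycleSubst_le_biPermSubst (m : ℕ) : rowCycleSubst m ≤ biPermSubst m :=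
  map_biPermHom_le m _

/-- The cyclic row notch has order `≤ m + 1` (exactly `m` for `m ≥ 2`). -/
theorem card_rowCycleSubst_le (m : ℕ) : Nat.card (rowCycleSubst m) ≤ m ^ 1 + 1 := by
  rw [rowCycleSubst, Subgroup.card_map_of_injective (biPermHom_injective m), Nat.card_zpowers,
    Prod.orderOf_mk, orderOf_one, Nat.lcm_one_right, pow_one]
  rcases Nat.lt_or_ge m 2 with hm | hm
  · have : Subsingleton (Fin m) := ⟨fun a b => Fin.ext (by have := a.isLt; have := b.isLt; omega)⟩
    rw [orderOf_eq_one_iff.mpr (Subsingleton.elim (finRotate m) 1)]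
    exact Nat.le_add_left 1 m
  · rw [(isCycle_finRotate_of_le hm).orderOf, support_finRotate_of_le hm, Finset.card_univ,
      Fintype.card_fin]
    exact Nat.le_succ m

/-- ★ The cyclic row notch symmetrises for free … -/
theorem symCheap_rowCycle : SymCheap rowCycleSubst :=
  symCheap_of_card (fun m => (rowCycleSubst_le_biPermSubst m).trans (biPermSubst_le_linStabilizer m))
    (fun m => finite_of_le_biPermSubst (rowCycleSubst_le_biPermSubst m)) ⟨1, card_rowCycleSubst_le⟩

/-- ★ … so cell A there is `W` in costume. -/
theorem eqHard_rowCycle_iff : EqHard rowCycleSubst ↔ DcPerSuperpolynomial ℂ :=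
  eqHard_iff_W_of_symCheap symCheap_rowCycle

/-! ### Instance 2: `P-ROW = P-ALT-ROW` -/

/-- P-ROW `𝔖_m × 1`: the row substitutions `x_{ij} ↦ x_{σ i, j}`. -/
def rowSubst (m : ℕ) : Subgroup (GL (Fin m × Fin m) ℂ) :=
  ((⊤ : Subgroup (Equiv.Perm (Fin m))).prod ⊥).map (biPermHom m)

/-- The alternating row notch `𝔄_m × 1`. -/
def rowAltSubst (m : ℕ) : Subgroup (GL (Fin m × Fin m) ℂ) :=
  ((alternatingGroup (Fin m)).prod ⊥).map (biPermHom m)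

/-- The alternating rows lie inside the rows. -/
theorem rowAltSubst_le_rowSubst (m : ℕ) : rowAltSubst m ≤ rowSubst m := by
  unfold rowAltSubst rowSubst
  exact Subgroup.map_mono (Subgroup.prod_mono le_top le_rfl)

/-- AUX: `K × 1` is the image of `K` under the left inclusion. [folklore] -/
theorem prod_bot_eq_map_inl {G N : Type*} [Group G] [Group N] (K : Subgroup G) :
    K.prod (⊥ : Subgroup N) = K.map (MonoidHom.inl G N) := by
  ext p
  simp only [Subgroup.mem_prod, Subgroup.mem_bot, Subgroup.mem_map, MonoidHom.inl_apply]
  constructor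
  · rintro ⟨h1, h2⟩
    exact ⟨p.1, h1, Prod.ext rfl h2.symm⟩
  · rintro ⟨x, hx, rfl⟩
    exact ⟨hx, rfl⟩

/-- AUX: the left inclusion `G →* G × N` is injective. [folklore] -/
theorem monoidHom_inl_injective (G N : Type*) [Group G] [Group N] :
    Function.Injective (MonoidHom.inl G N) :=
  fun _ _ h => congrArg Prod.fst h

/-- AUX: the alternating group has index at most `2` (index `1` on `≤ 1` letters). [folklore] -/
theorem index_alternatingGroup_le_two (α : Type*) [Fintype α] [DecidableEq α] :
    (alternatingGroup α).index ≤ 2 := by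
  rcases subsingleton_or_nontrivial α with hα | hα
  · exact (alternatingGroup.index_eq_one (α := α)).trans_le (by decide)
  · exact (alternatingGroup.index_eq_two (α := α)).le

/-- The alternating rows have index `≤ 2` in the rows. -/
theorem relIndex_rowAltSubst_le (m : ℕ) : (rowAltSubst m).relIndex (rowSubst m) ≤ 2 := by
  rw [rowAltSubst, rowSubst, relIndex_map_biPermHom, prod_bot_eq_map_inl, prod_bot_eq_map_inl,
    Subgroup.relIndex_map_map_of_injective _ _ (monoidHom_inl_injective _ _),
    Subgroup.relIndex_top_right]
  exact index_alternatingGroup_le_two (Fin m)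

/-- ★ The named open notch P-ROW is decided at the alternating rows and conversely. -/
theorem eqHard_row_iff_rowAlt : EqHard rowSubst ↔ EqHard rowAltSubst :=
  eqHard_iff_of_relIndex rowAltSubst_le_rowSubst (fun m => map_biPermHom_le m _)
    ⟨2, fun m => (relIndex_rowAltSubst_le m).trans (Nat.le_add_left 2 (m ^ 2))⟩
    fun m => relIndex_ne_zero_of_finite _ _ (finite_of_le_biPermSubst (map_biPermHom_le m _))

/-! ### Instance 3: the alternating diagonal `Δ𝔄_m` is HARD -/

/-- The diagonal embedding `σ ↦ (σ, σ)`. -/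
def diagHom (m : ℕ) : Equiv.Perm (Fin m) →* Equiv.Perm (Fin m) × Equiv.Perm (Fin m) :=
  (MonoidHom.id _).prod (MonoidHom.id _)

/-- AUX: the diagonal embedding is injective. [folklore] -/
theorem diagHom_injective (m : ℕ) : Function.Injective (diagHom m) :=
  fun _ _ h => congrArg Prod.fst h

/-- The alternating diagonal notch `Δ𝔄_m`: `x_{ij} ↦ x_{σ i, σ j}`, `σ` even. -/
def diagAltSubst (m : ℕ) : Subgroup (GL (Fin m × Fin m) ℂ) :=
  ((alternatingGroup (Fin m)).map (diagHom m)).map (biPermHom m)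

/-- The tree's diagonal notch `Δ𝔖_m` (`diagPermSubst`, a closure) is the image of the diagonal. -/
theorem diagPermSubst_eq_map (m : ℕ) :
    diagPermSubst m = ((⊤ : Subgroup (Equiv.Perm (Fin m))).map (diagHom m)).map (biPermHom m) := by
  refine le_antisymm ?_ ?_
  · rw [diagPermSubst, Subgroup.closure_le]
    rintro γ ⟨σ, hγ⟩
    exact Subgroup.mem_map.mpr ⟨(σ⁻¹, σ⁻¹), Subgroup.mem_map.mpr ⟨σ⁻¹, Subgroup.mem_top _, rfl⟩,
      Units.ext (by rw [coe_biPermHom, inv_inv, hγ])⟩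
  · rw [diagPermSubst]
    rintro _ ⟨_, ⟨σ, -, rfl⟩, rfl⟩
    exact Subgroup.subset_closure ⟨σ⁻¹, coe_biPermHom m σ σ⟩

/-- The alternating diagonal lies inside the diagonal notch. -/
theorem diagAltSubst_le_diagPermSubst (m : ℕ) : diagAltSubst m ≤ diagPermSubst m := by
  rw [diagAltSubst, diagPermSubst_eq_map]
  exact Subgroup.map_mono (Subgroup.map_mono le_top)

/-- The alternating diagonal has index `≤ 2` in the diagonal notch. -/
theorem relIndex_diagAltSubst_le (m : ℕ) : (diagAltSubst m).relIndex (diagPermSubst m) ≤ 2 := by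
  rw [diagAltSubst, diagPermSubst_eq_map, relIndex_map_biPermHom,
    Subgroup.relIndex_map_map_of_injective _ _ (diagHom_injective m), Subgroup.relIndex_top_right]
  exact index_alternatingGroup_le_two (Fin m)

/-- ★ Cell A holds at the alternating diagonal (a notch `⊉ Δ𝔖_m`, not reachable by monotonicity). -/
theorem eqHard_diagAlt : EqHard diagAltSubst :=
  (eqHard_iff_of_relIndex diagAltSubst_le_diagPermSubst diagPermSubst_le_biPermSubst
    ⟨2, fun m => (relIndex_diagAltSubst_le m).trans (Nat.le_add_left 2 (m ^ 2))⟩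
    fun m => relIndex_ne_zero_of_finite _ _
      (finite_of_le_biPermSubst (diagPermSubst_le_biPermSubst m))).mp eqHard_diag

end Summit.ValiantsHypothesis.ValiantsHypothesis.Theorems.EquivariantDialPolyIndex

end
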